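import Summits.QuantumFields.YangMills.Theorems.BalabanUVNodesN07EmapOfRecordRealSlice
import Summits.QuantumFields.YangMills.Theorems.BalabanUVNodesN07CslOfRecordTraceSectors
import Summits.QuantumFields.YangMills.Theorems.BalabanUVNodesN07H1ReadingTraceSectors
import HarnessLib

/-!
# NODE N07 — SECT. C's INNER FIXED POINT AND THE TRACE SECTORS: (i) `T = T47` COMMUTES WITH SCALAR TRANSLATIONS (`T(A′ + δ) = T(A′) + δ` for `Pδ = 0`), so
# `D(HD)(A′)δ = 0`, `D(HD₃)(A′)δ = 0`, `DT(A′)δ = δ` at every `N`; (ii) for Hermitian TRACELESS `A′` with `‖A′‖ < a_C` the fixed point `HD(A′)`, `T A′` are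
# Hermitian-TRACELESS-presented at `N = 2` (the (47) contraction preserves the closed Hermitian-traceless slice) — the `H`∕`C` half of the trace part of the
# «`W` maps `evHerm0` to `TZ`» ROW of def-Y's ✓`Node00.BgSchemeChartLie.lieTokAt_of_rows` ([15] (45)–(50) p. 285, (51) p. 286, (78) p. 290; [B9] p. 391–392)

Cell `pub-ymgap`, width seat `pub-ymgap-dag-n07-w3` (g27), CLAIM-3.  `--kind proof --supports stmt-QuantumFields-27238 --as helper`; count-neutral.
[15] = [Balaban1985Variational]; [B9] = [Balaban1985BackgroundPropagators].

THE ARGUMENT.  (i) `X := T A′ − A′` solves `X = −H(C(X + A′))` in `‖X‖ ≤ ε_C`; since `C = C^{𝔰𝔩}` does not see scalar directions (✓`CslOfRecord_add_of_slProjLit_eq_zero`),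
the same `X` solves the equation at `A′ + δ`, and Prop. 6-type uniqueness (lit ✓`Regime.eq_solA`) gives `T(A′ + δ) = T(A′) + δ`; the derivative identities follow along
the line `A′ + tδ` (✓`fderiv_apply_eq_of_eventually_line`; analyticity of `HD`, `HD₃`, `T` on the `a_C`-ball is lit's ✓`analyticOnNhd_Emap ∕ _E3 ∕ _T47` under `Prop4Hyp`).
(ii) as in ✓`…N07EmapOfRecordRealSlice` with the closed set «Hermitian AND traceless-presented»: invariance needs `C` to map such jets of norm `≤ ε_C + a_C` to Hermitian
(`hCreal`) and traceless (`hCtr`, cf. ✓`trace_CslOfRecord_eventually_nhds`) block fields, and `H♭` to map those to Hermitian (✓p821715) and traceless (✓p824079, `N = 2`) jets.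
* §1 `isClosed_tracelessJet`, `isClosed_herm0Jet`.
* §2 (abstract `H`, `C`, regime) ★`T47_add_of_blind`, `Emap_add_of_blind`, `fderiv_Emap_apply_eq_zero_of_blind`, `fderiv_T47_apply_eq_self_of_blind`, ★★`trace_equiv_Emap_eq_zero`,
  `trace_equiv_T47_eq_zero`.
* §3 (def-Y's letters `H♭ := H1OfRecordAtBgFlat`, `C^{𝔰𝔩} := CslOfRecord`; any `N`) ★`T47OfRecord_add`, `EmapOfRecord_add`, `E3OfRecord_add`, ★`fderiv_EmapOfRecord_apply_eq_zero`,
  ★`fderiv_E3OfRecord_apply_eq_zero`, ★`fderiv_T47OfRecord_apply_eq_self` (scalar `δ`, `‖A′‖ < a_C`; regime ∕ `Prop4Hyp` displayed).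
* §4 (`N = 2`; guard, regime, `hCreal`, `hCtr` displayed) ★★`trace_equiv_EmapOfRecord_eq_zero_two`, ★★`trace_equiv_T47OfRecord_eq_zero_two`.

HONEST LABELS.  Bookkeeping over lit's (47) contraction and the cited letters; Sect. C's regime, `Prop4Hyp`, `hCreal`, `hCtr` are DISPLAYED hypotheses (Bałaban's estimates ∕ the
small-field matching of neighbourhoods), NOT proved; `HD₃`'s second-order part and the `J`, `Δπ`, `V₀` letters of `W` are NOT here.  Count-neutral; N07 NOT discharged; P0 ⟨26900⟩ OPEN;
R4 is the conditional finite-𝕋⁴ rung only.  Nothing here is a claim about the Yang–Mills mass gap (`Summit.QuantumFields`): finite torus, fixed `ε`; nothing continuum ∕ OS ∕ Clay.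
-/

set_option autoImplicit false

noncomputable section

open scoped Matrix Matrix.Norms.L2Operator InnerProductSpace ComplexConjugate Topology

namespace Summit.QuantumFields.YangMills.Theorems.N07EmapOfRecordTraceSectors

open Filter Metric
open Literature.MathematicalPhysics.QuantumFieldTheory.Balaban1983to89
open Literature.MathematicalPhysics.QuantumFieldTheory.Balaban1983to89.T4Continuum (T4Family)
open T4Continuum BlockAveraging
open B9SectCLatticeCarrier (Bond)
open B11Eq111FrakG (nabla115)
open B11Eq115Space (NegSize NegSup levWeight JetSup)
open B11Eq80Current (Emap Emap_eq_sub quadPart E3 analyticOnNhd_Emap analyticOnNhd_E3)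
open B11Eq90V0GroupComposed (T47 T47_apply analyticOnNhd_T47)
open B11Eq174Chart (Regime solA)
open B11Prop6Scheme (mapT mapT_apply Prop4Hyp solution_mem_of_invariant)
open Node00
open Summit.QuantumFields.YangMills.Theorems.N07QuadPartReality (conjJet_add conjJet_sub conjJet_smul)
open Summit.QuantumFields.YangMills.Theorems.N07EmapOfRecordRealSlice (isClosed_hermJet conjJet_zero conjJet_neg conjJet_H1OfRecordAtBgFlat)
open Summit.QuantumFields.YangMills.Theorems.N07CslOfRecordTraceSectors (fderiv_apply_eq_of_eventually_line CslOfRecord_add_of_slProjLit_eq_zero quadPart_CslOfRecord_add)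
open Summit.QuantumFields.YangMills.Theorems.N07H1ReadingTraceSectors (trace_equiv_H1OfRecordAtBgFlat_eq_zero_two)

variable (F : T4Family) (N : ℕ) (K : ℕ) (k : ℕ) (Ω : ℕ → Set (Site (F.P K) 0)) (U₀ : GaugeField (F.P K) 0 (SU N))
  [Fact (0 < (F.L : ℝ))] [Fact (0 < (F.P K).eta k)] (levB : PBond (F.P K) k → ℕ)

/-! ## §1  The traceless and the Hermitian-traceless jets form closed sets -/

/-- **THE TRACELESS-PRESENTED JETS FORM A CLOSED SET** in the space (115) of record (a finite intersection of kernels of linear functionals, finite dimension).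
[cite: Balaban1985Variational, (51) p.286, (115) p.294] -/
theorem isClosed_tracelessJet :
    IsClosed {A : Space115Lit F N K k Ω U₀ | ∀ b, (JetSup.equiv _ _ (nabla115 ((F.P K).eta k) (unitsOfRecord F N U₀)) A b).trace = 0} := by
  have h : {A : Space115Lit F N K k Ω U₀ | ∀ b, (JetSup.equiv _ _ (nabla115 ((F.P K).eta k) (unitsOfRecord F N U₀)) A b).trace = 0} =
      ⋂ b, {A : Space115Lit F N K k Ω U₀ | (JetSup.equiv _ _ (nabla115 ((F.P K).eta k) (unitsOfRecord F N U₀)) A b).trace = 0} := by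
    ext A; simp only [Set.mem_setOf_eq, Set.mem_iInter]
  rw [h]
  refine isClosed_iInter fun b => ?_
  let ℓ : Space115Lit F N K k Ω U₀ →ₗ[ℂ] ℂ :=
    { toFun := fun A => (JetSup.equiv _ _ (nabla115 ((F.P K).eta k) (unitsOfRecord F N U₀)) A b).trace
      map_add' := fun A B => by rw [JetSup.equiv_add, Pi.add_apply, Matrix.trace_add]
      map_smul' := fun c A => by rw [JetSup.equiv_smul, Pi.smul_apply, Matrix.trace_smul, RingHom.id_apply] }
  exact isClosed_eq ℓ.continuous_of_finiteDimensional continuous_const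

/-- **THE HERMITIAN TRACELESS JETS (print's `𝔤`-valued `A′`, the fibre of def-Y's `evHerm0`) FORM A CLOSED SET.** [cite: Balaban1985Variational, (51) p.286, (115) p.294] -/
theorem isClosed_herm0Jet :
    IsClosed {A : Space115Lit F N K k Ω U₀ |
      ((JetSup.equiv _ _ (nabla115 ((F.P K).eta k) (unitsOfRecord F N U₀))).symm
          (star (JetSup.equiv _ _ (nabla115 ((F.P K).eta k) (unitsOfRecord F N U₀)) A)) : Space115Lit F N K k Ω U₀) = A ∧
        ∀ b, (JetSup.equiv _ _ (nabla115 ((F.P K).eta k) (unitsOfRecord F N U₀)) A b).trace = 0} :=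
  (isClosed_hermJet F N K k Ω U₀).inter (isClosed_tracelessJet F N K k Ω U₀)

omit [Fact (0 < (F.L : ℝ))] [Fact (0 < (F.P K).eta k)] in
/-- Bookkeeping: the presented field of `−Y` is `−` that of `Y`. [cite: Balaban1985Variational, (115) p.294 (bookkeeping)] -/
theorem jetEquiv_neg (Y : Space115Lit F N K k Ω U₀) :
    JetSup.equiv _ _ (nabla115 ((F.P K).eta k) (unitsOfRecord F N U₀)) (-Y) = -JetSup.equiv _ _ (nabla115 ((F.P K).eta k) (unitsOfRecord F N U₀)) Y := by
  rw [← zero_sub, JetSup.equiv_sub, JetSup.equiv_zero, zero_sub]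

/-! ## §2  Abstract `H`, `C` under Sect. C's regime -/

section Abstract

variable {H : NegSize (F.L : ℝ) ((F.P K).eta k) levB 0 (Matrix (Fin N) (Fin N) ℂ) →L[ℂ] Space115Lit F N K k Ω U₀}
  {C : Space115Lit F N K k Ω U₀ → NegSize (F.L : ℝ) ((F.P K).eta k) levB 0 (Matrix (Fin N) (Fin N) ℂ)} {b C₂ c₄ aC εC : ℝ}

/-- ★ **`T` COMMUTES WITH THE TRANSLATIONS `C` DOES NOT SEE**: if `C(Y + δ) = C(Y)` for all `Y`, then `T(A′ + δ) = T(A′) + δ` whenever both `A′` and `A′ + δ` lie in the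
`a_C`-ball — the solution `X = T A′ − A′` of `X = −H(C(X + A′))` also solves the equation at `A′ + δ`, and the solution in `‖X‖ ≤ ε_C` is unique (lit ✓`Regime.eq_solA`).
[cite: Balaban1985Variational, (47)–(50) p.285, Prop. 6 p.295] -/
theorem T47_add_of_blind (RC : Regime H 0 C b 0 C₂ c₄ 0 aC εC) {δ : Space115Lit F N K k Ω U₀} (hCδ : ∀ Y, C (Y + δ) = C Y)
    {A' : Space115Lit F N K k Ω U₀} (hA' : ‖A'‖ < aC) (hA'δ : ‖A' + δ‖ < aC) : T47 H C εC (A' + δ) = T47 H C εC A' + δ := by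
  have hJ : ‖(0 : NegSize (F.L : ℝ) ((F.P K).eta k) levB 0 (Matrix (Fin N) (Fin N) ℂ))‖ ≤ 0 := by rw [norm_zero]
  have hsol := RC.solA_mem hJ hA'
  have hfix : mapT H 0 C 0 (A' + δ) (solA H 0 C 0 εC A') = solA H 0 C 0 εC A' := by
    have h2 := hsol.2
    rw [mapT_apply] at h2 ⊢
    rw [← add_assoc, hCδ]
    simpa only [map_zero, zero_apply] using h2
  have huniq : solA H 0 C 0 εC A' = solA H 0 C 0 εC (A' + δ) := RC.eq_solA hJ hA'δ hsol.1 hfix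
  rw [T47_apply, T47_apply, ← huniq]
  abel

/-- **`HD(A′ + δ) = HD(A′)`** for a translation `C` does not see (both points in the `a_C`-ball). [cite: Balaban1985Variational, (47)–(49) p.285] -/
theorem Emap_add_of_blind (RC : Regime H 0 C b 0 C₂ c₄ 0 aC εC) {δ : Space115Lit F N K k Ω U₀} (hCδ : ∀ Y, C (Y + δ) = C Y)
    {A' : Space115Lit F N K k Ω U₀} (hA' : ‖A'‖ < aC) (hA'δ : ‖A' + δ‖ < aC) : Emap H C εC (A' + δ) = Emap H C εC A' := by
  rw [Emap_eq_sub, Emap_eq_sub, T47_add_of_blind F N K k Ω U₀ levB RC hCδ hA' hA'δ]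
  abel

/-- Along the line `A′ + tδ` the `a_C`-ball condition holds for `t` near `0`. [folklore] [cite: Balaban1985Variational, (63) p.287] -/
theorem eventually_norm_add_smul_lt_jet {A' δ : Space115Lit F N K k Ω U₀} (hA' : ‖A'‖ < aC) : ∀ᶠ t : ℂ in 𝓝 0, ‖A' + t • δ‖ < aC := by
  have hc : Continuous fun t : ℂ => ‖A' + t • δ‖ := (continuous_const.add (continuous_id.smul continuous_const)).norm
  have h0 : ‖A' + (0 : ℂ) • δ‖ < aC := by rwa [zero_smul, add_zero]
  exact hc.continuousAt.eventually (Iio_mem_nhds h0)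

/-- **`D(HD)(A′)δ = 0`** for a direction whose whole line `C` does not see (`‖A′‖ < a_C`; `HD` analytic on the ball under `Prop4Hyp`, lit ✓`analyticOnNhd_Emap`).
[cite: Balaban1985Variational, (63) p.287, (85)–(89) p.291] -/
theorem fderiv_Emap_apply_eq_zero_of_blind (RC : Regime H 0 C b 0 C₂ c₄ 0 aC εC) (hP : Prop4Hyp C C₂ c₄) {δ : Space115Lit F N K k Ω U₀}
    (hCδ : ∀ (t : ℂ) (Y : Space115Lit F N K k Ω U₀), C (Y + t • δ) = C Y) {A' : Space115Lit F N K k Ω U₀} (hA' : ‖A'‖ < aC) :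
    fderiv ℂ (Emap H C εC) A' δ = 0 := by
  have hA'mem : A' ∈ ball (0 : Space115Lit F N K k Ω U₀) aC := by rwa [mem_ball, dist_zero_right]
  refine fderiv_apply_eq_of_eventually_line ((analyticOnNhd_Emap RC hP) A' hA'mem).differentiableAt ?_
  filter_upwards [eventually_norm_add_smul_lt_jet F N K k Ω U₀ (δ := δ) hA'] with t ht
  rw [Emap_add_of_blind F N K k Ω U₀ levB RC (hCδ t) hA' ht, smul_zero, add_zero]

/-- **`DT(A′)δ = δ`** for a direction whose whole line `C` does not see (`‖A′‖ < a_C`; lit ✓`analyticOnNhd_T47`). [cite: Balaban1985Variational, (63) p.287, (90) p.291] -/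
theorem fderiv_T47_apply_eq_self_of_blind (RC : Regime H 0 C b 0 C₂ c₄ 0 aC εC) (hP : Prop4Hyp C C₂ c₄) {δ : Space115Lit F N K k Ω U₀}
    (hCδ : ∀ (t : ℂ) (Y : Space115Lit F N K k Ω U₀), C (Y + t • δ) = C Y) {A' : Space115Lit F N K k Ω U₀} (hA' : ‖A'‖ < aC) :
    fderiv ℂ (T47 H C εC) A' δ = δ := by
  have hA'mem : A' ∈ ball (0 : Space115Lit F N K k Ω U₀) aC := by rwa [mem_ball, dist_zero_right]
  refine fderiv_apply_eq_of_eventually_line ((analyticOnNhd_T47 RC hP) A' hA'mem).differentiableAt ?_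
  filter_upwards [eventually_norm_add_smul_lt_jet F N K k Ω U₀ (δ := δ) hA'] with t ht
  rw [T47_add_of_blind F N K k Ω U₀ levB RC (hCδ t) hA' ht]

/-- ★★ **`HD(A′) = Emap H C ε_C A′` IS TRACELESS-PRESENTED FOR HERMITIAN TRACELESS `A′` WITH `‖A′‖ < a_C`** — under Sect. C's regime (displayed), for `H` real and mapping
traceless block fields to traceless jets, and `C` mapping Hermitian traceless jets of norm `≤ ε_C + a_C` to Hermitian (`hCreal`) and traceless (`hCtr`) block fields: the (47)
contraction preserves the closed Hermitian-traceless slice, so its fixed point lies in it (lit ✓`solution_mem_of_invariant`). [cite: Balaban1985Variational, (45)–(50) p.285, (51) p.286] -/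
theorem trace_equiv_Emap_eq_zero (RC : Regime H 0 C b 0 C₂ c₄ 0 aC εC)
    (hH : ∀ B : NegSize (F.L : ℝ) ((F.P K).eta k) levB 0 (Matrix (Fin N) (Fin N) ℂ),
      ((JetSup.equiv _ _ (nabla115 ((F.P K).eta k) (unitsOfRecord F N U₀))).symm
          (star (JetSup.equiv _ _ (nabla115 ((F.P K).eta k) (unitsOfRecord F N U₀)) (H B))) : Space115Lit F N K k Ω U₀) =
        H ((NegSup.equiv _ _).symm (star (NegSup.equiv _ _ B))))
    (hHtr : ∀ B : NegSize (F.L : ℝ) ((F.P K).eta k) levB 0 (Matrix (Fin N) (Fin N) ℂ), (∀ c, (NegSup.equiv _ _ B c).trace = 0) →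
      ∀ b, (JetSup.equiv _ _ (nabla115 ((F.P K).eta k) (unitsOfRecord F N U₀)) (H B) b).trace = 0)
    (hCreal : ∀ A : Space115Lit F N K k Ω U₀,
      ((JetSup.equiv _ _ (nabla115 ((F.P K).eta k) (unitsOfRecord F N U₀))).symm
          (star (JetSup.equiv _ _ (nabla115 ((F.P K).eta k) (unitsOfRecord F N U₀)) A)) : Space115Lit F N K k Ω U₀) = A →
      ‖A‖ ≤ εC + aC → ((NegSup.equiv _ _).symm (star (NegSup.equiv _ _ (C A))) : NegSize (F.L : ℝ) ((F.P K).eta k) levB 0 (Matrix (Fin N) (Fin N) ℂ)) = C A)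
    (hCtr : ∀ A : Space115Lit F N K k Ω U₀,
      ((JetSup.equiv _ _ (nabla115 ((F.P K).eta k) (unitsOfRecord F N U₀))).symm
          (star (JetSup.equiv _ _ (nabla115 ((F.P K).eta k) (unitsOfRecord F N U₀)) A)) : Space115Lit F N K k Ω U₀) = A →
      (∀ b, (JetSup.equiv _ _ (nabla115 ((F.P K).eta k) (unitsOfRecord F N U₀)) A b).trace = 0) →
      ‖A‖ ≤ εC + aC → ∀ c, (NegSup.equiv _ _ (C A) c).trace = 0)
    {A' : Space115Lit F N K k Ω U₀}
    (hA' : ((JetSup.equiv _ _ (nabla115 ((F.P K).eta k) (unitsOfRecord F N U₀))).symm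
      (star (JetSup.equiv _ _ (nabla115 ((F.P K).eta k) (unitsOfRecord F N U₀)) A')) : Space115Lit F N K k Ω U₀) = A')
    (hA'tr : ∀ b, (JetSup.equiv _ _ (nabla115 ((F.P K).eta k) (unitsOfRecord F N U₀)) A' b).trace = 0) (hn : ‖A'‖ < aC)
    (b' : Bond (F.P K).d (fun _ => (F.P K).sitesPerDir 0)) :
    (JetSup.equiv _ _ (nabla115 ((F.P K).eta k) (unitsOfRecord F N U₀)) (Emap H C εC A') b').trace = 0 := by
  have hJ : ‖(0 : NegSize (F.L : ℝ) ((F.P K).eta k) levB 0 (Matrix (Fin N) (Fin N) ℂ))‖ ≤ 0 := by rw [norm_zero]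
  have hsol := RC.solA_mem hJ hn
  -- the fixed point lies in the closed invariant Hermitian-traceless slice
  have hmem : solA H 0 C 0 εC A' ∈ {A : Space115Lit F N K k Ω U₀ |
      ((JetSup.equiv _ _ (nabla115 ((F.P K).eta k) (unitsOfRecord F N U₀))).symm
          (star (JetSup.equiv _ _ (nabla115 ((F.P K).eta k) (unitsOfRecord F N U₀)) A)) : Space115Lit F N K k Ω U₀) = A ∧
        ∀ b, (JetSup.equiv _ _ (nabla115 ((F.P K).eta k) (unitsOfRecord F N U₀)) A b).trace = 0} := by
    refine solution_mem_of_invariant RC.norm_G RC.norm_L RC.quad RC.B₀_nonneg RC.C₄_nonneg RC.θ_nonneg hJ hn RC.ε₄_nonneg RC.dom RC.self RC.contr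
      _ (isClosed_herm0Jet F N K k Ω U₀) ⟨conjJet_zero F N K k Ω U₀, fun b => by rw [JetSup.equiv_zero, Pi.zero_apply, Matrix.trace_zero]⟩
      (fun X hX hXn => ?_) hsol.1 hsol.2
    obtain ⟨hX', hXtr⟩ := hX
    have hXA : ((JetSup.equiv _ _ (nabla115 ((F.P K).eta k) (unitsOfRecord F N U₀))).symm
        (star (JetSup.equiv _ _ (nabla115 ((F.P K).eta k) (unitsOfRecord F N U₀)) (X + A'))) : Space115Lit F N K k Ω U₀) = X + A' := by
      rw [conjJet_add, hX', hA']
    have hXAtr : ∀ b, (JetSup.equiv _ _ (nabla115 ((F.P K).eta k) (unitsOfRecord F N U₀)) (X + A') b).trace = 0 := fun b => by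
      rw [JetSup.equiv_add, Pi.add_apply, Matrix.trace_add, hXtr b, hA'tr b, add_zero]
    have hXAn : ‖X + A'‖ ≤ εC + aC := (norm_add_le _ _).trans (add_le_add hXn hn.le)
    have hCX := hCreal (X + A') hXA hXAn
    have hCXtr := hCtr (X + A') hXA hXAtr hXAn
    have hT : mapT H 0 C 0 A' X = -H (C (X + A')) := by
      rw [mapT_apply, map_zero, neg_zero, zero_add, zero_apply, zero_sub]
    refine ⟨?_, fun b => ?_⟩
    · show ((JetSup.equiv _ _ (nabla115 ((F.P K).eta k) (unitsOfRecord F N U₀))).symm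
          (star (JetSup.equiv _ _ (nabla115 ((F.P K).eta k) (unitsOfRecord F N U₀)) (mapT H 0 C 0 A' X))) : Space115Lit F N K k Ω U₀) = mapT H 0 C 0 A' X
      rw [hT, conjJet_neg, hH, hCX]
    · show (JetSup.equiv _ _ (nabla115 ((F.P K).eta k) (unitsOfRecord F N U₀)) (mapT H 0 C 0 A' X) b).trace = 0
      rw [hT, jetEquiv_neg, Pi.neg_apply, Matrix.trace_neg, hHtr _ hCXtr b, neg_zero]
  rw [Emap, jetEquiv_neg, Pi.neg_apply, Matrix.trace_neg, hmem.2 b', neg_zero]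

/-- **`T A′ = A′ − HD(A′)` IS TRACELESS-PRESENTED** on the Hermitian-traceless slice (`‖A′‖ < a_C`; same displayed rows). [cite: Balaban1985Variational, (47) p.285, (51) p.286] -/
theorem trace_equiv_T47_eq_zero (RC : Regime H 0 C b 0 C₂ c₄ 0 aC εC)
    (hH : ∀ B : NegSize (F.L : ℝ) ((F.P K).eta k) levB 0 (Matrix (Fin N) (Fin N) ℂ),
      ((JetSup.equiv _ _ (nabla115 ((F.P K).eta k) (unitsOfRecord F N U₀))).symm
          (star (JetSup.equiv _ _ (nabla115 ((F.P K).eta k) (unitsOfRecord F N U₀)) (H B))) : Space115Lit F N K k Ω U₀) =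
        H ((NegSup.equiv _ _).symm (star (NegSup.equiv _ _ B))))
    (hHtr : ∀ B : NegSize (F.L : ℝ) ((F.P K).eta k) levB 0 (Matrix (Fin N) (Fin N) ℂ), (∀ c, (NegSup.equiv _ _ B c).trace = 0) →
      ∀ b, (JetSup.equiv _ _ (nabla115 ((F.P K).eta k) (unitsOfRecord F N U₀)) (H B) b).trace = 0)
    (hCreal : ∀ A : Space115Lit F N K k Ω U₀,
      ((JetSup.equiv _ _ (nabla115 ((F.P K).eta k) (unitsOfRecord F N U₀))).symm
          (star (JetSup.equiv _ _ (nabla115 ((F.P K).eta k) (unitsOfRecord F N U₀)) A)) : Space115Lit F N K k Ω U₀) = A →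
      ‖A‖ ≤ εC + aC → ((NegSup.equiv _ _).symm (star (NegSup.equiv _ _ (C A))) : NegSize (F.L : ℝ) ((F.P K).eta k) levB 0 (Matrix (Fin N) (Fin N) ℂ)) = C A)
    (hCtr : ∀ A : Space115Lit F N K k Ω U₀,
      ((JetSup.equiv _ _ (nabla115 ((F.P K).eta k) (unitsOfRecord F N U₀))).symm
          (star (JetSup.equiv _ _ (nabla115 ((F.P K).eta k) (unitsOfRecord F N U₀)) A)) : Space115Lit F N K k Ω U₀) = A →
      (∀ b, (JetSup.equiv _ _ (nabla115 ((F.P K).eta k) (unitsOfRecord F N U₀)) A b).trace = 0) →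
      ‖A‖ ≤ εC + aC → ∀ c, (NegSup.equiv _ _ (C A) c).trace = 0)
    {A' : Space115Lit F N K k Ω U₀}
    (hA' : ((JetSup.equiv _ _ (nabla115 ((F.P K).eta k) (unitsOfRecord F N U₀))).symm
      (star (JetSup.equiv _ _ (nabla115 ((F.P K).eta k) (unitsOfRecord F N U₀)) A')) : Space115Lit F N K k Ω U₀) = A')
    (hA'tr : ∀ b, (JetSup.equiv _ _ (nabla115 ((F.P K).eta k) (unitsOfRecord F N U₀)) A' b).trace = 0) (hn : ‖A'‖ < aC)
    (b' : Bond (F.P K).d (fun _ => (F.P K).sitesPerDir 0)) :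
    (JetSup.equiv _ _ (nabla115 ((F.P K).eta k) (unitsOfRecord F N U₀)) (T47 H C εC A') b').trace = 0 := by
  have hE := trace_equiv_Emap_eq_zero F N K k Ω U₀ levB RC hH hHtr hCreal hCtr hA' hA'tr hn b'
  rw [Emap_eq_sub, JetSup.equiv_sub, Pi.sub_apply, Matrix.trace_sub, hA'tr b', zero_sub, neg_eq_zero] at hE
  exact hE

end Abstract

/-! ## §3  At def-Y's letters `H♭`, `C^{𝔰𝔩}`: scalar translations, any `N` -/

section Record

variable [NeZero N] [Fact (0 < c0Rec F K k)] [Fact (∀ c, 0 < wBRec F K k c)] {a : ℝ}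
  (hposb : ∀ x, x ≠ 0 → 0 < RCLike.re ⟪x, laplaceAOfRecord F N k U₀ (QOfRecord F N k U₀) (QflatOfRecord F N k) a x⟫_ℂ)
  (hQ : Function.Surjective (QOfRecord F N k U₀)) {b C₂ c₄ aC εC : ℝ}
  (RC : Regime (H1OfRecordAtBgFlat F N K k Ω U₀ levB a hposb hQ) 0 (CslOfRecord F N K k Ω U₀ levB) b 0 C₂ c₄ 0 aC εC)

include RC in
/-- ★ **AT def-Y's LETTERS: `T(A′ + δ) = T(A′) + δ` FOR A SCALAR-PRESENTED `δ`** (`Pδ = 0`; `A′`, `A′ + δ` in the `a_C`-ball; Sect. C regime displayed).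
[cite: Balaban1985Variational, (47)–(50) p.285, (51) p.286] -/
theorem T47OfRecord_add {δ : Space115Lit F N K k Ω U₀} (hδ : slProjLit F N K k Ω U₀ δ = 0) {A' : Space115Lit F N K k Ω U₀} (hA' : ‖A'‖ < aC) (hA'δ : ‖A' + δ‖ < aC) :
    T47 (H1OfRecordAtBgFlat F N K k Ω U₀ levB a hposb hQ) (CslOfRecord F N K k Ω U₀ levB) εC (A' + δ) =
      T47 (H1OfRecordAtBgFlat F N K k Ω U₀ levB a hposb hQ) (CslOfRecord F N K k Ω U₀ levB) εC A' + δ :=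
  T47_add_of_blind F N K k Ω U₀ levB RC (CslOfRecord_add_of_slProjLit_eq_zero F N K k Ω U₀ levB hδ) hA' hA'δ

include RC in
/-- **`HD(A′ + δ) = HD(A′)`** for a scalar-presented `δ` at def-Y's letters. [cite: Balaban1985Variational, (47)–(49) p.285, (51) p.286] -/
theorem EmapOfRecord_add {δ : Space115Lit F N K k Ω U₀} (hδ : slProjLit F N K k Ω U₀ δ = 0) {A' : Space115Lit F N K k Ω U₀} (hA' : ‖A'‖ < aC) (hA'δ : ‖A' + δ‖ < aC) :
    Emap (H1OfRecordAtBgFlat F N K k Ω U₀ levB a hposb hQ) (CslOfRecord F N K k Ω U₀ levB) εC (A' + δ) =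
      Emap (H1OfRecordAtBgFlat F N K k Ω U₀ levB a hposb hQ) (CslOfRecord F N K k Ω U₀ levB) εC A' :=
  Emap_add_of_blind F N K k Ω U₀ levB RC (CslOfRecord_add_of_slProjLit_eq_zero F N K k Ω U₀ levB hδ) hA' hA'δ

include RC in
/-- **`HD₃(A′ + δ) = HD₃(A′)`** for a scalar-presented `δ` (the second-order part `C⁽²⁾` is blind to `δ` too, ✓`quadPart_CslOfRecord_add`). [cite: Balaban1985Variational, (78) p.290, (56) p.286] -/
theorem E3OfRecord_add {δ : Space115Lit F N K k Ω U₀} (hδ : slProjLit F N K k Ω U₀ δ = 0) {A' : Space115Lit F N K k Ω U₀} (hA' : ‖A'‖ < aC) (hA'δ : ‖A' + δ‖ < aC) :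
    E3 (H1OfRecordAtBgFlat F N K k Ω U₀ levB a hposb hQ) (CslOfRecord F N K k Ω U₀ levB) εC (A' + δ) =
      E3 (H1OfRecordAtBgFlat F N K k Ω U₀ levB a hposb hQ) (CslOfRecord F N K k Ω U₀ levB) εC A' := by
  rw [E3, E3, EmapOfRecord_add F N K k Ω U₀ levB hposb hQ RC hδ hA' hA'δ, quadPart_CslOfRecord_add F N K k Ω U₀ levB hδ]

include RC in
/-- ★ **`D(HD)(A′)δ = 0` FOR A SCALAR-PRESENTED `δ`** at def-Y's letters (`‖A′‖ < a_C`; regime ∕ `Prop4Hyp` displayed). [cite: Balaban1985Variational, (63) p.287, (88)–(89) p.291] -/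
theorem fderiv_EmapOfRecord_apply_eq_zero (hP : Prop4Hyp (CslOfRecord F N K k Ω U₀ levB) C₂ c₄) {δ : Space115Lit F N K k Ω U₀}
    (hδ : slProjLit F N K k Ω U₀ δ = 0) {A' : Space115Lit F N K k Ω U₀} (hA' : ‖A'‖ < aC) :
    fderiv ℂ (Emap (H1OfRecordAtBgFlat F N K k Ω U₀ levB a hposb hQ) (CslOfRecord F N K k Ω U₀ levB) εC) A' δ = 0 :=
  fderiv_Emap_apply_eq_zero_of_blind F N K k Ω U₀ levB RC hP
    (fun t Y => CslOfRecord_add_of_slProjLit_eq_zero F N K k Ω U₀ levB (by rw [map_smul, hδ, smul_zero]) Y) hA'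

include RC in
/-- ★ **`D(HD₃)(A′)δ = 0` FOR A SCALAR-PRESENTED `δ`** at def-Y's letters (`‖A′‖ < a_C`; lit ✓`analyticOnNhd_E3`). [cite: Balaban1985Variational, (63) p.287, (85) p.291] -/
theorem fderiv_E3OfRecord_apply_eq_zero (hP : Prop4Hyp (CslOfRecord F N K k Ω U₀ levB) C₂ c₄) {δ : Space115Lit F N K k Ω U₀}
    (hδ : slProjLit F N K k Ω U₀ δ = 0) {A' : Space115Lit F N K k Ω U₀} (hA' : ‖A'‖ < aC) :
    fderiv ℂ (E3 (H1OfRecordAtBgFlat F N K k Ω U₀ levB a hposb hQ) (CslOfRecord F N K k Ω U₀ levB) εC) A' δ = 0 := by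
  haveI : CompleteSpace (NegSize (F.L : ℝ) ((F.P K).eta k) levB 0 (Matrix (Fin N) (Fin N) ℂ)) := FiniteDimensional.complete ℂ _
  have hA'mem : A' ∈ ball (0 : Space115Lit F N K k Ω U₀) aC := by rwa [mem_ball, dist_zero_right]
  refine fderiv_apply_eq_of_eventually_line ((analyticOnNhd_E3 RC hP) A' hA'mem).differentiableAt ?_
  filter_upwards [eventually_norm_add_smul_lt_jet F N K k Ω U₀ (δ := δ) hA'] with t ht
  rw [E3OfRecord_add F N K k Ω U₀ levB hposb hQ RC (by rw [map_smul, hδ, smul_zero]) hA' ht, smul_zero, add_zero]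

include RC in
/-- ★ **`DT(A′)δ = δ` FOR A SCALAR-PRESENTED `δ`** at def-Y's letters (`‖A′‖ < a_C`; lit ✓`analyticOnNhd_T47`). [cite: Balaban1985Variational, (63) p.287, (90) p.291] -/
theorem fderiv_T47OfRecord_apply_eq_self (hP : Prop4Hyp (CslOfRecord F N K k Ω U₀ levB) C₂ c₄) {δ : Space115Lit F N K k Ω U₀}
    (hδ : slProjLit F N K k Ω U₀ δ = 0) {A' : Space115Lit F N K k Ω U₀} (hA' : ‖A'‖ < aC) :
    fderiv ℂ (T47 (H1OfRecordAtBgFlat F N K k Ω U₀ levB a hposb hQ) (CslOfRecord F N K k Ω U₀ levB) εC) A' δ = δ :=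
  fderiv_T47_apply_eq_self_of_blind F N K k Ω U₀ levB RC hP
    (fun t Y => CslOfRecord_add_of_slProjLit_eq_zero F N K k Ω U₀ levB (by rw [map_smul, hδ, smul_zero]) Y) hA'

end Record

/-! ## §4  At def-Y's letters, `N = 2`: the fixed point on the Hermitian-traceless slice -/

section Two

variable (F : T4Family) {K : ℕ} (k : ℕ) (Ω : ℕ → Set (Site (F.P K) 0)) (U₀ : GaugeField (F.P K) 0 (SU 2))
  [Fact (0 < (F.L : ℝ))] [Fact (0 < (F.P K).eta k)] (levB : PBond (F.P K) k → ℕ) [Fact (0 < c0Rec F K k)] [Fact (∀ c, 0 < wBRec F K k c)] {a : ℝ}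
  (hposb : ∀ x, x ≠ 0 → 0 < RCLike.re ⟪x, laplaceAOfRecord F 2 k U₀ (QOfRecord F 2 k U₀) (QflatOfRecord F 2 k) a x⟫_ℂ)
  (hQ : Function.Surjective (QOfRecord F 2 k U₀)) {b C₂ c₄ aC εC : ℝ}
  (RC : Regime (H1OfRecordAtBgFlat F 2 K k Ω U₀ levB a hposb hQ) 0 (CslOfRecord F 2 K k Ω U₀ levB) b 0 C₂ c₄ 0 aC εC)
  (hCreal : ∀ A : Space115Lit F 2 K k Ω U₀,
    ((JetSup.equiv _ _ (nabla115 ((F.P K).eta k) (unitsOfRecord F 2 U₀))).symm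
        (star (JetSup.equiv _ _ (nabla115 ((F.P K).eta k) (unitsOfRecord F 2 U₀)) A)) : Space115Lit F 2 K k Ω U₀) = A →
    ‖A‖ ≤ εC + aC → ((NegSup.equiv _ _).symm (star (NegSup.equiv _ _ (CslOfRecord F 2 K k Ω U₀ levB A))) :
      NegSize (F.L : ℝ) ((F.P K).eta k) levB 0 (Matrix (Fin 2) (Fin 2) ℂ)) = CslOfRecord F 2 K k Ω U₀ levB A)
  (hCtr : ∀ A : Space115Lit F 2 K k Ω U₀,
    ((JetSup.equiv _ _ (nabla115 ((F.P K).eta k) (unitsOfRecord F 2 U₀))).symm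
        (star (JetSup.equiv _ _ (nabla115 ((F.P K).eta k) (unitsOfRecord F 2 U₀)) A)) : Space115Lit F 2 K k Ω U₀) = A →
    (∀ b, (JetSup.equiv _ _ (nabla115 ((F.P K).eta k) (unitsOfRecord F 2 U₀)) A b).trace = 0) →
    ‖A‖ ≤ εC + aC → ∀ c, (NegSup.equiv _ _ (CslOfRecord F 2 K k Ω U₀ levB A) c).trace = 0)

include RC hCreal hCtr in
set_option maxHeartbeats 800000 in
/-- ★★ **AT def-Y's LETTERS, `N = 2`: `HD(A′) = Emap H♭ C^{𝔰𝔩} ε_C A′` IS TRACELESS-PRESENTED for Hermitian traceless `A′`, `‖A′‖ < a_C`** (guard; Sect. C regime, `hCreal`,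
`hCtr` displayed; `H♭` real ✓p821715 and trace-preserving ✓p824079). [cite: Balaban1985Variational, (45)–(50) p.285, (51) p.286] -/
theorem trace_equiv_EmapOfRecord_eq_zero_two (h : SmallBelow (avOfRecord F 2 K) k U₀) {A' : Space115Lit F 2 K k Ω U₀}
    (hA' : ((JetSup.equiv _ _ (nabla115 ((F.P K).eta k) (unitsOfRecord F 2 U₀))).symm
      (star (JetSup.equiv _ _ (nabla115 ((F.P K).eta k) (unitsOfRecord F 2 U₀)) A')) : Space115Lit F 2 K k Ω U₀) = A')
    (hA'tr : ∀ b, (JetSup.equiv _ _ (nabla115 ((F.P K).eta k) (unitsOfRecord F 2 U₀)) A' b).trace = 0) (hn : ‖A'‖ < aC)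
    (b' : Bond (F.P K).d (fun _ => (F.P K).sitesPerDir 0)) :
    (JetSup.equiv _ _ (nabla115 ((F.P K).eta k) (unitsOfRecord F 2 U₀))
      (Emap (H1OfRecordAtBgFlat F 2 K k Ω U₀ levB a hposb hQ) (CslOfRecord F 2 K k Ω U₀ levB) εC A') b').trace = 0 :=
  trace_equiv_Emap_eq_zero F 2 K k Ω U₀ levB RC (conjJet_H1OfRecordAtBgFlat F 2 K k Ω U₀ levB hposb hQ h)
    (fun _ hB b => trace_equiv_H1OfRecordAtBgFlat_eq_zero_two F k U₀ Ω levB h hposb hQ hB b) hCreal hCtr hA' hA'tr hn b'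

include RC hCreal hCtr in
set_option maxHeartbeats 800000 in
/-- ★★ **AT def-Y's LETTERS, `N = 2`: `T A′` IS TRACELESS-PRESENTED** for Hermitian traceless `A′`, `‖A′‖ < a_C` (same displayed rows). [cite: Balaban1985Variational, (47) p.285, (51) p.286] -/
theorem trace_equiv_T47OfRecord_eq_zero_two (h : SmallBelow (avOfRecord F 2 K) k U₀) {A' : Space115Lit F 2 K k Ω U₀}
    (hA' : ((JetSup.equiv _ _ (nabla115 ((F.P K).eta k) (unitsOfRecord F 2 U₀))).symm
      (star (JetSup.equiv _ _ (nabla115 ((F.P K).eta k) (unitsOfRecord F 2 U₀)) A')) : Space115Lit F 2 K k Ω U₀) = A')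
    (hA'tr : ∀ b, (JetSup.equiv _ _ (nabla115 ((F.P K).eta k) (unitsOfRecord F 2 U₀)) A' b).trace = 0) (hn : ‖A'‖ < aC)
    (b' : Bond (F.P K).d (fun _ => (F.P K).sitesPerDir 0)) :
    (JetSup.equiv _ _ (nabla115 ((F.P K).eta k) (unitsOfRecord F 2 U₀))
      (T47 (H1OfRecordAtBgFlat F 2 K k Ω U₀ levB a hposb hQ) (CslOfRecord F 2 K k Ω U₀ levB) εC A') b').trace = 0 :=
  trace_equiv_T47_eq_zero F 2 K k Ω U₀ levB RC (conjJet_H1OfRecordAtBgFlat F 2 K k Ω U₀ levB hposb hQ h)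
    (fun _ hB b => trace_equiv_H1OfRecordAtBgFlat_eq_zero_two F k U₀ Ω levB h hposb hQ hB b) hCreal hCtr hA' hA'tr hn b'

end Two

end Summit.QuantumFields.YangMills.Theorems.N07EmapOfRecordTraceSectors

end
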